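import Literature.NumberTheory.Weil1965.SplitPlaceFibreMeasure
import Literature.NumberTheory.Weil1965.SplitPlaceInvariantMeasureUniqueness
import Literature.NumberTheory.Automorphic.GLnDotProductOrbitTransitive
import Literature.NumberTheory.Automorphic.FiniteAdeleFactorizable
import HarnessLib

/-!
# The fibre measure `μ_{b,v}` of the split form: regularity, support, `GL`-invariance, non-vanishing, uniqueness

Topic `NumberTheory/Weil1965`; namespace `Literature.NumberTheory.Weil1965.SplitPlace`.  KERNEL ONLY: theorems; no definition,
no named fact, no instance, no `sorry`.

Sequel to `SplitPlaceFibreMeasure` (the Riesz–Markov–Kakutani measure `fibreMeasure μ hι b` on `K^ι × K^ι` representing the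
limit `Λ_b` of the normalised slab averages `μ(𝔭^r)⁻¹ ∫ 𝟙_{b+𝔭^r}(x ⬝ᵥ y) f(x, y)`, `|ι| ≥ 2`).  This file turns the
`C_c`-level facts of that file into the MEASURE-level package that Weil's n° 49 Lemme 22 / n° 52 Thm. 5 consume at a finite
place `v` of `F` split in `E` (where `U(V)(F_v) ≅ GL_N(F_v)` and the hermitian form becomes the split pairing `x ⬝ᵥ y`):

* §1 `regular_fibreMeasure`, `isFiniteMeasureOnCompacts_fibreMeasure` — `μ_{b,v}` is a regular Borel measure, finite on
  compact sets;
* §2 SUPPORT: `fibreFunctional_eq_zero_of_tsupport` (the functional kills test functions supported off the fibre),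
  `fibreMeasure_eq_zero_of_isCompact`, `fibreMeasure_eq_zero_of_isOpen`, **`fibreMeasure_compl_fibre`**
  (`μ_{b,v}({x ⬝ᵥ y = b}ᶜ) = 0`) and, for `b ≠ 0`, `fibreMeasure_compl_splitLocus_of_ne_zero` (`μ_{b,v}` is carried by the
  orbit `S_b = {x ⬝ᵥ y = b, x ≠ 0, y ≠ 0}`);
* §3 INVARIANCE: **`map_fibreMeasure_dualPair`** (`(g, g′)_* μ_{b,v} = μ_{b,v}` for every dual pair `g u ⬝ᵥ g′ w = u ⬝ᵥ w`,
  by Riesz–Markov uniqueness `Measure.ext_of_integral_eq_on_compactlySupported` from ★ `integral_fibreMeasure_comp_dual`),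
  `fibreMeasure_preimage_dualPair`, and the same in the `GL n K`-currency `z ↦ (g *ᵥ z.1, (g⁻¹)ᵀ *ᵥ z.2)` of
  `SplitPlaceInvariantMeasureUniqueness` / `GLnDotProductOrbitTransitive`: **`fibreMeasure_preimage_gl`**;
* §4 NON-VANISHING: **`re_fibreDensity_indicator_boxProd_pos`** (`Re F_{𝟙_{(𝔭^n)^ι × (𝔭^n)^ι}}(b) > 0` whenever
  `b ∈ 𝔭^{2n}` — the shell of level `n` contributes `μ(𝔭^{2n})⁻¹ μ^ι((𝔭^n)^ι)` each), hence **`fibreMeasure_ne_zero`**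
  (every `b`, including the cone `b = 0`);
* §5 THE CONE `b = 0` (Weil's `U(0)_v` = isotropic vectors OF MAXIMAL RANK, i.e. `x ≠ 0 ≠ y` at a split place):
  `map_fibreMeasure_swap` (`μ_{b,v}` is symmetric in `(x, y)`), **`integral_indicator_boxProd_fibreMeasure_zero`**
  (`μ_{0,v}((𝔭^n)^ι × (𝔭^M)^ι) = μ^ι((𝔭^M)^ι) ∫_{(𝔭^n)^ι} μ(𝔭^{M + level x})⁻¹ dx`), `tendsto_setIntegral_levelWeight_box`
  (`→ 0` as `n → ∞` by ★ `integrableOn_levelWeight`, `|ι| ≥ 2`), hence **`fibreMeasure_zero_fst_eq_zero`** /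
  **`fibreMeasure_zero_snd_eq_zero`** (`μ_{0,v}({x = 0}) = μ_{0,v}({y = 0}) = 0`: the degenerate `GL`-orbits of the cone
  are null) and **`fibreMeasure_compl_splitLocus`** for EVERY `b`;
* §6 UNIQUENESS JUNCTION: **`exists_eq_smul_fibreMeasure`** — for every `b` (cone included), every Borel measure on
  `K^ι × K^ι` finite on compacts, invariant under `GL_ι(K)` and carried by `S_b` is `c • μ_{b,v}` (`c : ℝ≥0`): B-p21's
  `exists_eq_smul_of_dotProduct_invariant` with `μ′ := μ_{b,v}`; and Weil's RELATIVE form over an auxiliary factor `Y`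
  (the prime-to-`v` adeles): **`exists_measure_prod_splitLocus_eq_mul_fibreMeasure`** (`μ(A × B) = c_B · μ_{b,v}(A)`),
  **`exists_lintegral_fst_mul_indicator_snd_eq_mul_fibreMeasure`** (`∫ f(z) 𝟙_B(y) dμ = c_B ∫ f dμ_{b,v}`) — B-p21's
  `exists_measure_prod_splitLocus_eq_mul` / `exists_lintegral_fst_mul_indicator_snd_splitLocus_eq_mul` with `μ₀ := μ_{b,v}`.

Sources: A. Weil, *Sur la formule de Siegel dans la théorie des groupes classiques*, Acta Math. 113 (1965), Chap. IV n° 44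
Thm 2 (p. 63: the measures `|θ_i|_v` on the fibres), Chap. V n° 49 Lemma 22 (p. 70: invariant measures on `U(i)_v`,
uniqueness), Chap. VI n° 52 Thm 5 (p. 76); A. Weil, *Basic Number Theory* (1967), Ch. II §2 (boxes), Ch. II §5 Prop. 12.

USE (cell `hodgecm-mathlib`, FLOOR-0 P4, ENGINE E-2 child `Cruxes/H413/Lines/F0_E2SiegelWeilWeilRange.lean`, stub
`stub_SW2_siegelWeil`, identity road (W), rows I-SPLIT (this seat) ⨝ I-UNIQ (B-p21 (g22) ★ p801783) ⨝ G2-SPLIT (A-p10 (g16) ★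
p801087)): the Eisenstein-side local measure at the auxiliary split place IS the unique `GL_N(F_v)`-invariant measure on
`U(b)_v` up to the scalar fixed by `integral_fibreMeasure_eq_fibreDensity`.  HC_CM is proved only modulo the printed
citations until rung 0 closes.
-/

namespace Literature.NumberTheory.Weil1965.SplitPlace

open _root_.MeasureTheory _root_.Filter _root_.Set Literature.NumberTheory.Automorphic
open Literature.NumberTheory.Automorphic.LocalFieldHaar
open _root_.Topology
open scoped Pointwise NNReal ENNReal Matrix
open Literature.NumberTheory.GaloisRepresentations.IsNonarchimedeanLocalField
open CompactlySupported

variable {K : Type*} [Field K] [ValuativeRel K] [TopologicalSpace K] [IsNonarchimedeanLocalField K]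
variable {ι : Type*} [Fintype ι] [MeasurableSpace K] [BorelSpace K] (μ : Measure K) [μ.IsAddHaarMeasure]

omit [MeasurableSpace K] [BorelSpace K] in
/-- instance helper: `K` is second countable. [folklore] -/
private theorem secondCountableS : SecondCountableTopology K := secondCountableTopology_localField K

omit [MeasurableSpace K] [BorelSpace K] in
/-- instance helper: `K` is Hausdorff. [folklore] -/
private theorem t2S : T2Space K :=
  (Literature.NumberTheory.GaloisRepresentations.IsNonarchimedeanLocalField.isLocalField K).toT2Space

omit [MeasurableSpace K] [BorelSpace K] in
/-- instance helper: `K` is locally compact. [folklore] -/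
private theorem locallyCompactS : LocallyCompactSpace K :=
  (Literature.NumberTheory.GaloisRepresentations.IsNonarchimedeanLocalField.isLocalField K).toLocallyCompactSpace

omit [BorelSpace K] in
/-- instance helper: a Haar measure on `K` is `σ`-finite. [folklore] -/
private theorem sigmaFiniteS : SigmaFinite μ := by
  haveI : T2Space K := t2S
  haveI : LocallyCompactSpace K := locallyCompactS
  haveI : SecondCountableTopology K := secondCountableS
  infer_instance

/-! ## §1 Regularity -/

/-- `μ_{b,v}` is a regular Borel measure (Riesz–Markov–Kakutani). [cite: Weil1965, Chap. IV n° 44 Thm 2, p. 63] -/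
theorem regular_fibreMeasure [Nonempty ι] [DecidableEq ι] [MeasurableSingletonClass K] (hι : 2 ≤ Fintype.card ι) (b : K) :
    (fibreMeasure μ hι b).Regular := by
  haveI : SecondCountableTopology K := secondCountableS
  haveI : T2Space K := t2S
  haveI : LocallyCompactSpace K := locallyCompactS
  exact RealRMK.regular_rieszMeasure (fibreFunctional μ hι b)

/-- `μ_{b,v}` is finite on compact sets. [cite: Weil1965, Chap. IV n° 44 Thm 2, p. 63] -/
theorem isFiniteMeasureOnCompacts_fibreMeasure [Nonempty ι] [DecidableEq ι] [MeasurableSingletonClass K]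
    (hι : 2 ≤ Fintype.card ι) (b : K) : IsFiniteMeasureOnCompacts (fibreMeasure μ hι b) := by
  haveI := regular_fibreMeasure μ hι b
  infer_instance

/-! ## §2 Support: `μ_{b,v}` is carried by the fibre `{x ⬝ᵥ y = b}` -/

omit [BorelSpace K] [μ.IsAddHaarMeasure] in
/-- deep slab averages of a test function supported off the fibre `{x ⬝ᵥ y = b}` vanish identically: the compact set
`h(tsupport f)` misses `b`, hence misses `b + 𝔭^r` for `r ≫ 0`. [cite: Weil1965, Chap. IV n° 44 Thm 2, p. 63] -/
theorem eventually_fibreAvgReal_eq_zero (f : C_c((ι → K) × (ι → K), ℝ)) {b : K}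
    (hf : ∀ z ∈ tsupport (f : (ι → K) × (ι → K) → ℝ), z.1 ⬝ᵥ z.2 ≠ b) :
    ∀ᶠ r : ℤ in atTop, fibreAvgReal μ f b r = 0 := by
  haveI : T2Space K := t2S
  set h : (ι → K) × (ι → K) → K := fun z => z.1 ⬝ᵥ z.2 with hh
  have hcont : Continuous h := continuous_fst.dotProduct continuous_snd
  have hc : IsCompact (h '' tsupport (f : (ι → K) × (ι → K) → ℝ)) := f.hasCompactSupport.isCompact.image hcont
  have hW : (h '' tsupport (f : (ι → K) × (ι → K) → ℝ))ᶜ ∈ 𝓝 b :=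
    hc.isClosed.isOpen_compl.mem_nhds (by
      rintro ⟨z, hz, hzb⟩
      exact hf z hz hzb)
  have hW0 : (fun c : K => b + c) ⁻¹' (h '' tsupport (f : (ι → K) × (ι → K) → ℝ))ᶜ ∈ 𝓝 (0 : K) :=
    (continuous_const_add b).continuousAt.preimage_mem_nhds (by simpa only [add_zero] using hW)
  obtain ⟨n, hn⟩ := exists_primePowBall_subset_of_mem_nhds_zero hW0
  refine eventually_atTop.2 ⟨(n : ℤ), fun r hr => ?_⟩
  have hzero : ∀ z : (ι → K) × (ι → K),
      (b +ᵥ primePowBall K r).indicator (1 : K → ℝ) (z.1 ⬝ᵥ z.2) * f z = 0 := by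
    intro z
    by_cases hz : z.1 ⬝ᵥ z.2 ∈ b +ᵥ primePowBall K r
    · have hmem : z.1 ⬝ᵥ z.2 - b ∈ primePowBall K (n : ℤ) :=
        primePowBall_antitone hr (mem_vadd_primePowBall_iff.1 hz)
      have hzs : z ∉ tsupport (f : (ι → K) × (ι → K) → ℝ) := by
        intro hzs
        have h1 := hn hmem
        rw [Set.mem_preimage, add_sub_cancel, Set.mem_compl_iff] at h1
        exact h1 ⟨z, hzs, rfl⟩
      rw [image_eq_zero_of_notMem_tsupport hzs, mul_zero]
    · rw [Set.indicator_of_notMem hz, zero_mul]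
  simp only [fibreAvgReal, hzero, integral_zero, mul_zero]

/-- **the fibre functional kills test functions supported off the fibre**: `Λ_b f = 0` if `tsupport f ∩ {x ⬝ᵥ y = b} = ∅`.
[cite: Weil1965, Chap. IV n° 44 Thm 2, p. 63] -/
theorem fibreFunctional_eq_zero_of_tsupport [Nonempty ι] [DecidableEq ι] [MeasurableSingletonClass K]
    (hι : 2 ≤ Fintype.card ι) (b : K) (f : C_c((ι → K) × (ι → K), ℝ))
    (hf : ∀ z ∈ tsupport (f : (ι → K) × (ι → K) → ℝ), z.1 ⬝ᵥ z.2 ≠ b) :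
    fibreFunctional μ hι b f = 0 := by
  have h1 := tendsto_fibreFunctional μ hι b f
  have h2 : Tendsto (fun r : ℤ => fibreAvgReal μ f b r) atTop (𝓝 0) :=
    tendsto_const_nhds.congr' (by
      filter_upwards [eventually_fibreAvgReal_eq_zero μ f hf] with r hr using hr.symm)
  exact tendsto_nhds_unique h1 h2

/-- hence `∫ f ∂μ_{b,v} = 0` for such `f`. [cite: Weil1965, Chap. IV n° 44 Thm 2, p. 63] -/
theorem integral_fibreMeasure_eq_zero_of_tsupport [Nonempty ι] [DecidableEq ι] [MeasurableSingletonClass K]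
    (hι : 2 ≤ Fintype.card ι) (b : K) (f : C_c((ι → K) × (ι → K), ℝ))
    (hf : ∀ z ∈ tsupport (f : (ι → K) × (ι → K) → ℝ), z.1 ⬝ᵥ z.2 ≠ b) :
    ∫ z, f z ∂(fibreMeasure μ hι b) = 0 := by
  rw [integral_fibreMeasure, fibreFunctional_eq_zero_of_tsupport μ hι b f hf]

/-- **compact sets off the fibre are `μ_{b,v}`-null** (Urysohn function `= 1` on the compact set, supported in the open
complement of the fibre, and `μ(C) ≤ Λ_b f = 0`). [cite: Weil1965, Chap. IV n° 44 Thm 2, p. 63] -/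
theorem fibreMeasure_eq_zero_of_isCompact [Nonempty ι] [DecidableEq ι] [MeasurableSingletonClass K]
    (hι : 2 ≤ Fintype.card ι) (b : K) {C : Set ((ι → K) × (ι → K))} (hC : IsCompact C)
    (hCb : ∀ z ∈ C, z.1 ⬝ᵥ z.2 ≠ b) : fibreMeasure μ hι b C = 0 := by
  haveI : SecondCountableTopology K := secondCountableS
  haveI : T2Space K := t2S
  haveI : LocallyCompactSpace K := locallyCompactS
  have hU : IsOpen {z : (ι → K) × (ι → K) | z.1 ⬝ᵥ z.2 ≠ b} :=
    isOpen_ne_fun (continuous_fst.dotProduct continuous_snd) continuous_const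
  obtain ⟨g, hg1, hg2, hg3, hg4⟩ := exists_continuousMap_one_of_isCompact_subset_isOpen hC hU hCb
  set f : C_c((ι → K) × (ι → K), ℝ) := ⟨g, hasCompactSupport_def.mpr hg2⟩ with hfdef
  have hle : fibreMeasure μ hι b C ≤ ENNReal.ofReal (fibreFunctional μ hι b f) :=
    RealRMK.rieszMeasure_le_of_eq_one (Λ := fibreFunctional μ hι b) (f := f) (fun x => (hg4 x).1) hC
      (fun x hx => hg1 hx)
  have h0 : fibreFunctional μ hι b f = 0 :=
    fibreFunctional_eq_zero_of_tsupport μ hι b f (fun z hz => hg3 hz)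
  rw [h0, ENNReal.ofReal_zero, nonpos_iff_eq_zero] at hle
  exact hle

/-- **open sets off the fibre are `μ_{b,v}`-null** (inner regularity). [cite: Weil1965, Chap. IV n° 44 Thm 2, p. 63] -/
theorem fibreMeasure_eq_zero_of_isOpen [Nonempty ι] [DecidableEq ι] [MeasurableSingletonClass K]
    (hι : 2 ≤ Fintype.card ι) (b : K) {U : Set ((ι → K) × (ι → K))} (hU : IsOpen U)
    (hUb : ∀ z ∈ U, z.1 ⬝ᵥ z.2 ≠ b) : fibreMeasure μ hι b U = 0 := by
  haveI := regular_fibreMeasure μ hι b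
  rw [hU.measure_eq_iSup_isCompact]
  simp only [ENNReal.iSup_eq_zero]
  intro C hCU hC
  exact fibreMeasure_eq_zero_of_isCompact μ hι b hC (fun z hz => hUb z (hCU hz))

/-- **`μ_{b,v}` IS CARRIED BY THE FIBRE**: `μ_{b,v}({(x, y) | x ⬝ᵥ y = b}ᶜ) = 0`. [cite: Weil1965, Chap. IV n° 44 Thm 2, p. 63] -/
theorem fibreMeasure_compl_fibre [Nonempty ι] [DecidableEq ι] [MeasurableSingletonClass K]
    (hι : 2 ≤ Fintype.card ι) (b : K) :
    fibreMeasure μ hι b {z : (ι → K) × (ι → K) | z.1 ⬝ᵥ z.2 = b}ᶜ = 0 := by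
  haveI : T2Space K := t2S
  exact fibreMeasure_eq_zero_of_isOpen μ hι b
    (isClosed_eq (continuous_fst.dotProduct continuous_snd) continuous_const).isOpen_compl (fun z hz => hz)

omit [ValuativeRel K] [TopologicalSpace K] [IsNonarchimedeanLocalField K] [MeasurableSpace K] [BorelSpace K] in
/-- for `b ≠ 0` the fibre `{x ⬝ᵥ y = b}` is the orbit `S_b = {x ⬝ᵥ y = b, x ≠ 0, y ≠ 0}` (both vectors are automatically
non-zero). [cite: Weil1965, Chap. V n° 49 Lemma 22, p. 70] -/
theorem splitLocus_eq_fibre {b : K} (hb : b ≠ 0) :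
    {z : (ι → K) × (ι → K) | z.1 ⬝ᵥ z.2 = b ∧ z.1 ≠ 0 ∧ z.2 ≠ 0} = {z | z.1 ⬝ᵥ z.2 = b} := by
  ext z
  simp only [mem_setOf_eq]
  constructor
  · exact fun h => h.1
  · intro h
    refine ⟨h, ?_, ?_⟩
    · intro h0
      apply hb
      rw [← h, h0, zero_dotProduct]
    · intro h0
      apply hb
      rw [← h, h0, dotProduct_zero]

/-- **for `b ≠ 0`, `μ_{b,v}` is carried by the `GL`-orbit `S_b = {x ⬝ᵥ y = b, x ≠ 0, y ≠ 0}`** — the carrier hypothesis of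
`exists_eq_smul_of_dotProduct_invariant`. [cite: Weil1965, Chap. V n° 49 Lemma 22, p. 70] -/
theorem fibreMeasure_compl_splitLocus_of_ne_zero [Nonempty ι] [DecidableEq ι] [MeasurableSingletonClass K]
    (hι : 2 ≤ Fintype.card ι) {b : K} (hb : b ≠ 0) :
    fibreMeasure μ hι b {z : (ι → K) × (ι → K) | z.1 ⬝ᵥ z.2 = b ∧ z.1 ≠ 0 ∧ z.2 ≠ 0}ᶜ = 0 := by
  rw [splitLocus_eq_fibre hb]
  exact fibreMeasure_compl_fibre μ hι b

/-! ## §3 Invariance at the level of measures -/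

omit [MeasurableSpace K] [BorelSpace K] in
/-- a linear automorphism of `K^ι` is continuous. [cite: WeilBNT1967, Ch. II §2, Def. 2] -/
theorem continuous_linearEquiv_pi (g : (ι → K) ≃ₗ[K] (ι → K)) : Continuous g :=
  LinearMap.continuous_on_pi g.toLinearMap

/-- **functional invariance ⇒ measure invariance** (Riesz–Markov uniqueness): if a homeomorphism `T` of `K^ι × K^ι`
satisfies `Λ_b(f ∘ T) = Λ_b(f)` on `C_c`, then `T_* μ_{b,v} = μ_{b,v}` — both sides are regular and integrate every `f ∈ C_c`
to the same value (`Measure.ext_of_integral_eq_on_compactlySupported`). [cite: Weil1965, Chap. V n° 49 Lemma 22, p. 70] -/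
theorem map_fibreMeasure_homeomorph [Nonempty ι] [DecidableEq ι] [MeasurableSingletonClass K]
    (hι : 2 ≤ Fintype.card ι) (b : K) (T : (ι → K) × (ι → K) ≃ₜ (ι → K) × (ι → K))
    (hT : ∀ f fT : C_c((ι → K) × (ι → K), ℝ), (∀ z, fT z = f (T z)) → fibreFunctional μ hι b fT = fibreFunctional μ hι b f) :
    (fibreMeasure μ hι b).map T = fibreMeasure μ hι b := by
  haveI : SecondCountableTopology K := secondCountableS
  haveI : T2Space K := t2S
  haveI : LocallyCompactSpace K := locallyCompactS
  haveI := regular_fibreMeasure μ hι b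
  haveI : ((fibreMeasure μ hι b).map T).Regular := Measure.Regular.map T
  refine Measure.ext_of_integral_eq_on_compactlySupported fun f => ?_
  rw [← Homeomorph.toMeasurableEquiv_coe, integral_map_equiv, Homeomorph.toMeasurableEquiv_coe]
  set fT : C_c((ι → K) × (ι → K), ℝ) :=
    ⟨⟨fun z => f (T z), f.continuous.comp T.continuous⟩, f.hasCompactSupport.comp_homeomorph T⟩ with hfT
  have h := hT f fT (fun z => rfl)
  have e1 : ∫ x, f (T x) ∂(fibreMeasure μ hι b) = ∫ x, fT x ∂(fibreMeasure μ hι b) := rfl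
  rw [e1, integral_fibreMeasure, integral_fibreMeasure, h]

/-- **`(g, g′)_* μ_{b,v} = μ_{b,v}` FOR EVERY DUAL PAIR** (`g u ⬝ᵥ g′ w = u ⬝ᵥ w`): both sides are regular and integrate
every `f ∈ C_c` to the same value (★ `integral_fibreMeasure_comp_dual`), so they agree
(`Measure.ext_of_integral_eq_on_compactlySupported`). At a split place this is the `U(V)(F_v) ≅ GL_N(F_v)`-invariance of
Weil's `|θ_b|_v`. [cite: Weil1965, Chap. V n° 49 Lemma 22, p. 70] -/
theorem map_fibreMeasure_dualPair [Nonempty ι] [DecidableEq ι] [MeasurableSingletonClass K]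
    (hι : 2 ≤ Fintype.card ι) (b : K) (g g' : (ι → K) ≃ₗ[K] (ι → K)) (hgg' : ∀ x y, g x ⬝ᵥ g' y = x ⬝ᵥ y) :
    (fibreMeasure μ hι b).map (fun z => (g z.1, g' z.2)) = fibreMeasure μ hι b := by
  -- the map as a homeomorphism
  set Tg : (ι → K) ≃ₜ (ι → K) :=
    { g.toEquiv with
      continuous_toFun := continuous_linearEquiv_pi g
      continuous_invFun := continuous_linearEquiv_pi g.symm } with hTg
  set Tg' : (ι → K) ≃ₜ (ι → K) :=
    { g'.toEquiv with
      continuous_toFun := continuous_linearEquiv_pi g'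
      continuous_invFun := continuous_linearEquiv_pi g'.symm } with hTg'
  set T : (ι → K) × (ι → K) ≃ₜ (ι → K) × (ι → K) := Tg.prodCongr Tg' with hT
  have hTfun : (fun z : (ι → K) × (ι → K) => (g z.1, g' z.2)) = ⇑T := by
    funext z
    rfl
  rw [hTfun]
  exact map_fibreMeasure_homeomorph μ hι b T (fun f fT hfT =>
    fibreFunctional_comp_dual μ hι b g g' hgg' f fT (fun z => hfT z))

/-- the same in preimage form: `μ_{b,v}((g, g′)⁻¹ A) = μ_{b,v}(A)` for Borel `A`. [cite: Weil1965, Chap. V n° 49 Lemma 22, p. 70] -/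
theorem fibreMeasure_preimage_dualPair [Nonempty ι] [DecidableEq ι] [MeasurableSingletonClass K]
    (hι : 2 ≤ Fintype.card ι) (b : K) (g g' : (ι → K) ≃ₗ[K] (ι → K)) (hgg' : ∀ x y, g x ⬝ᵥ g' y = x ⬝ᵥ y)
    {A : Set ((ι → K) × (ι → K))} (hA : MeasurableSet A) :
    fibreMeasure μ hι b ((fun z : (ι → K) × (ι → K) => (g z.1, g' z.2)) ⁻¹' A) = fibreMeasure μ hι b A := by
  haveI : SecondCountableTopology K := secondCountableS
  have hm : Measurable (fun z : (ι → K) × (ι → K) => (g z.1, g' z.2)) :=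
    ((continuous_linearEquiv_pi g).comp continuous_fst).measurable.prodMk
      ((continuous_linearEquiv_pi g').comp continuous_snd).measurable
  rw [← Measure.map_apply hm hA, map_fibreMeasure_dualPair μ hι b g g' hgg']

/-- **`GL_N`-INVARIANCE IN MATRIX CURRENCY**: `μ_{b,v}` is invariant under `(x, y) ↦ (g x, (g⁻¹)ᵀ y)`, `g ∈ GL_ι(K)` — the
hypothesis shape of `exists_eq_smul_of_dotProduct_invariant` (the pair `(g, (g⁻¹)ᵀ)` is dual:
`GLnDotProduct.dotProduct_mulVec_transpose_inv_mulVec`). [cite: Weil1965, Chap. V n° 49 Lemma 22, p. 70] -/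
theorem fibreMeasure_preimage_gl [Nonempty ι] [DecidableEq ι] [MeasurableSingletonClass K]
    (hι : 2 ≤ Fintype.card ι) (b : K) (g : GL ι K) {A : Set ((ι → K) × (ι → K))} (hA : MeasurableSet A) :
    fibreMeasure μ hι b ((fun z : (ι → K) × (ι → K) =>
        (((g : Matrix ι ι K) *ᵥ z.1, ((g⁻¹ : GL ι K) : Matrix ι ι K)ᵀ *ᵥ z.2) : (ι → K) × (ι → K))) ⁻¹' A) =
      fibreMeasure μ hι b A := by
  -- the two linear automorphisms `x ↦ g x` and `y ↦ (g⁻¹)ᵀ y`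
  have h1 : (Matrix.toLin' (g : Matrix ι ι K)).comp (Matrix.toLin' ((g⁻¹ : GL ι K) : Matrix ι ι K)) = LinearMap.id := by
    rw [← Matrix.toLin'_mul, ← Units.val_mul, mul_inv_cancel, Units.val_one, Matrix.toLin'_one]
  have h2 : (Matrix.toLin' ((g⁻¹ : GL ι K) : Matrix ι ι K)).comp (Matrix.toLin' (g : Matrix ι ι K)) = LinearMap.id := by
    rw [← Matrix.toLin'_mul, ← Units.val_mul, inv_mul_cancel, Units.val_one, Matrix.toLin'_one]
  have h3 : (Matrix.toLin' ((g⁻¹ : GL ι K) : Matrix ι ι K)ᵀ).comp (Matrix.toLin' (g : Matrix ι ι K)ᵀ) = LinearMap.id := by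
    rw [← Matrix.toLin'_mul, ← Matrix.transpose_mul, ← Units.val_mul, mul_inv_cancel, Units.val_one,
      Matrix.transpose_one, Matrix.toLin'_one]
  have h4 : (Matrix.toLin' (g : Matrix ι ι K)ᵀ).comp (Matrix.toLin' ((g⁻¹ : GL ι K) : Matrix ι ι K)ᵀ) = LinearMap.id := by
    rw [← Matrix.toLin'_mul, ← Matrix.transpose_mul, ← Units.val_mul, inv_mul_cancel, Units.val_one,
      Matrix.transpose_one, Matrix.toLin'_one]
  set eg : (ι → K) ≃ₗ[K] (ι → K) :=
    LinearEquiv.ofLinear (Matrix.toLin' (g : Matrix ι ι K)) (Matrix.toLin' ((g⁻¹ : GL ι K) : Matrix ι ι K)) h1 h2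
    with heg
  set eg' : (ι → K) ≃ₗ[K] (ι → K) :=
    LinearEquiv.ofLinear (Matrix.toLin' ((g⁻¹ : GL ι K) : Matrix ι ι K)ᵀ) (Matrix.toLin' (g : Matrix ι ι K)ᵀ) h3 h4
    with heg'
  have heg_apply : ∀ x, eg x = (g : Matrix ι ι K) *ᵥ x := fun x => by
    rw [heg, LinearEquiv.ofLinear_apply, Matrix.toLin'_apply]
  have heg'_apply : ∀ y, eg' y = ((g⁻¹ : GL ι K) : Matrix ι ι K)ᵀ *ᵥ y := fun y => by
    rw [heg', LinearEquiv.ofLinear_apply, Matrix.toLin'_apply]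
  have hgg' : ∀ x y, eg x ⬝ᵥ eg' y = x ⬝ᵥ y := fun x y => by
    rw [heg_apply, heg'_apply]
    exact GLnDotProduct.dotProduct_mulVec_transpose_inv_mulVec g x y
  have hfun : (fun z : (ι → K) × (ι → K) =>
      (((g : Matrix ι ι K) *ᵥ z.1, ((g⁻¹ : GL ι K) : Matrix ι ι K)ᵀ *ᵥ z.2) : (ι → K) × (ι → K))) =
      fun z => (eg z.1, eg' z.2) := by
    funext z
    rw [heg_apply, heg'_apply]
  rw [hfun]
  exact fibreMeasure_preimage_dualPair μ hι b eg eg' hgg' hA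

/-! ## §4 Non-vanishing: `μ_{b,v} ≠ 0` -/

omit [Fintype ι] [MeasurableSpace K] [BorelSpace K] in
/-- boxes are translation-stable: `y + t ∈ (𝔭^n)^ι ↔ y ∈ (𝔭^n)^ι` for `t ∈ (𝔭^n)^ι`. [cite: WeilBNT1967, Ch. II §2, Def. 2] -/
theorem add_mem_piPrimePowBall_iff_of_mem {n : ℤ} {y t : ι → K} (ht : t ∈ piPrimePowBall K ι n) :
    y + t ∈ piPrimePowBall K ι n ↔ y ∈ piPrimePowBall K ι n := by
  constructor
  · intro h
    have : y + t + -t ∈ piPrimePowBall K ι n := add_mem_piPrimePowBall h (neg_mem_piPrimePowBall ht)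
    simpa using this
  · intro h
    exact add_mem_piPrimePowBall h ht

/-- the shell `(𝔭^n)^ι ∖ (𝔭^{n+1})^ι` has positive `μ^ι`-measure (it is open, and non-empty because
`μ(𝔭^{n+1}) = q⁻¹ μ(𝔭^n) < μ(𝔭^n)`). [cite: WeilBNT1967, Ch. II §2, Def. 2] -/
theorem measureReal_shell_pos [Nonempty ι] (n : ℤ) :
    0 < (Measure.pi fun _ : ι => μ).real (piPrimePowBall K ι n \ piPrimePowBall K ι (n + 1)) := by
  haveI : T2Space K := t2S
  haveI : LocallyCompactSpace K := locallyCompactS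
  haveI : SecondCountableTopology K := secondCountableS
  haveI := sigmaFiniteS μ
  -- a point of `𝔭^n ∖ 𝔭^{n+1}`
  have hlt : μ.real (primePowBall K (n + 1)) < μ.real (primePowBall K n) := by
    rw [show n + 1 = 1 + n by ring, measureReal_primePowBall_add μ 1 n, zpow_one]
    have hq : ((residueFieldCard K : ℝ)⁻¹) < 1 :=
      inv_lt_one_of_one_lt₀ (by exact_mod_cast one_lt_residueFieldCard (F := K))
    exact mul_lt_of_lt_one_left (measureReal_primePowBall_pos μ n) hq
  have hex : ∃ a : K, a ∈ primePowBall K n ∧ a ∉ primePowBall K (n + 1) := by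
    by_contra hcon
    push Not at hcon
    exact absurd (measureReal_mono (μ := μ) (fun a ha => hcon a ha) (measure_primePowBall_lt_top μ (n + 1)).ne)
      (not_le.2 hlt)
  obtain ⟨a, ha, ha'⟩ := hex
  obtain ⟨i₀⟩ := ‹Nonempty ι›
  have hne : (piPrimePowBall K ι n \ piPrimePowBall K ι (n + 1)).Nonempty := by
    refine ⟨fun _ => a, mem_piPrimePowBall_iff.2 fun _ => ha, fun h => ha' ?_⟩
    exact (mem_piPrimePowBall_iff.1 h) i₀
  have hopen : IsOpen (piPrimePowBall K ι n \ piPrimePowBall K ι (n + 1)) :=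
    (isOpen_piPrimePowBall n).sdiff (isClosed_piPrimePowBall (n + 1))
  exact ENNReal.toReal_pos (hopen.measure_pos _ hne).ne'
    ((measure_mono Set.sdiff_subset).trans_lt (measure_pi_piPrimePowBall_lt_top μ n)).ne

/-- **the slice density of the box indicator at every `b`**: for `x` of level `k` in `(𝔭^n)^ι` (so `n ≤ k`),
`s(x, 𝟙_{(𝔭^n)^ι}; b) = μ(𝔭^{n+k})⁻¹ · μ^ι({y ∈ (𝔭^n)^ι | x ⬝ᵥ y ∈ b + 𝔭^{n+k}})` — a non-negative real; and the set is
ALL of `(𝔭^n)^ι` when `b ∈ 𝔭^{n+k}` (then `x ⬝ᵥ y ∈ 𝔭^{n+k} = b + 𝔭^{n+k}` automatically).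
[cite: Weil1965, Chap. III n° 37 Prop. 6, p. 54] -/
theorem sliceDensity_indicator_box [Nonempty ι] [DecidableEq ι] {n k : ℤ} {x : ι → K}
    (hx : x ∈ piPrimePowBall K ι k \ piPrimePowBall K ι (k + 1)) (b : K) :
    sliceDensity μ x ((piPrimePowBall K ι n).indicator fun _ => (1 : ℂ)) b =
      ((μ.real (primePowBall K (n + k)))⁻¹ : ℝ) *
        (((Measure.pi fun _ : ι => μ).real
          ({y : ι → K | x ⬝ᵥ y ∈ b +ᵥ primePowBall K (n + k)} ∩ piPrimePowBall K ι n) : ℝ) : ℂ) := by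
  haveI : SecondCountableTopology K := secondCountableS
  haveI := sigmaFiniteS μ
  set f : (ι → K) → ℂ := (piPrimePowBall K ι n).indicator fun _ => (1 : ℂ) with hf
  have hfinv : ∀ y, ∀ t ∈ piPrimePowBall K ι n, f (y + t) = f y := by
    intro y t ht
    by_cases hy : y ∈ piPrimePowBall K ι n
    · rw [hf, Set.indicator_of_mem hy, Set.indicator_of_mem ((add_mem_piPrimePowBall_iff_of_mem ht).2 hy)]
    · rw [hf, Set.indicator_of_notMem hy,
        Set.indicator_of_notMem (fun h => hy ((add_mem_piPrimePowBall_iff_of_mem ht).1 h))]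
  have hfi : Integrable f (Measure.pi fun _ : ι => μ) :=
    (integrable_indicator_iff (measurableSet_piPrimePowBall' n)).2
      ((integrableOn_const_iff (C := (1 : ℂ))).2 (Or.inr (measure_pi_piPrimePowBall_lt_top μ n)))
  rw [sliceDensity_eq μ hx hfinv hfi b, sliceIntegral]
  -- the slab integrand is the indicator of `S = {x ⬝ᵥ y ∈ b + 𝔭^{n+k}} ∩ (𝔭^n)^ι`
  set S : Set (ι → K) := {y : ι → K | x ⬝ᵥ y ∈ b +ᵥ primePowBall K (n + k)} ∩ piPrimePowBall K ι n with hS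
  have hSm : MeasurableSet S :=
    ((measurableSet_vadd_primePowBall (n + k) b).preimage (continuous_dotProduct_right x).measurable).inter
      (measurableSet_piPrimePowBall' n)
  have hint : (fun y => (b +ᵥ primePowBall K (n + k)).indicator (1 : K → ℂ) (x ⬝ᵥ y) * f y) =
      S.indicator fun _ => (1 : ℂ) := by
    funext y
    by_cases hy : y ∈ piPrimePowBall K ι n
    · by_cases hxy : x ⬝ᵥ y ∈ b +ᵥ primePowBall K (n + k)
      · rw [Set.indicator_of_mem hxy, hf, Set.indicator_of_mem hy, Set.indicator_of_mem (show y ∈ S from ⟨hxy, hy⟩)]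
        simp
      · rw [Set.indicator_of_notMem hxy, zero_mul, Set.indicator_of_notMem (show y ∉ S from fun h => hxy h.1)]
    · rw [hf, Set.indicator_of_notMem hy, mul_zero, Set.indicator_of_notMem (show y ∉ S from fun h => hy h.2)]
  rw [hint, integral_indicator_const _ hSm, Complex.real_smul, mul_one, Complex.ofReal_inv]

/-- hence `Re s(x, 𝟙_{(𝔭^n)^ι}; b) ≥ 0` for every `x ≠ 0`. [cite: Weil1965, Chap. III n° 37 Prop. 6, p. 54] -/
theorem re_sliceDensity_indicator_box_nonneg [Nonempty ι] [DecidableEq ι] (n : ℤ) {x : ι → K} (hx0 : x ≠ 0) (b : K) :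
    0 ≤ (sliceDensity μ x ((piPrimePowBall K ι n).indicator fun _ => (1 : ℂ)) b).re := by
  rw [sliceDensity_indicator_box μ (mem_shell_level hx0) b, ← Complex.ofReal_mul, Complex.ofReal_re]
  exact mul_nonneg (inv_nonneg.2 measureReal_nonneg) measureReal_nonneg

/-- and `s(x, 𝟙_{(𝔭^n)^ι}; b) = μ(𝔭^{n+k})⁻¹ μ^ι((𝔭^n)^ι)` on the shell `level x = k` as soon as `b ∈ 𝔭^{n+k}` (the slab
condition `x ⬝ᵥ y ∈ b + 𝔭^{n+k}` is then automatic on the box). [cite: Weil1965, Chap. III n° 37 Prop. 6, p. 54] -/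
theorem sliceDensity_indicator_box_of_mem [Nonempty ι] [DecidableEq ι] {n k : ℤ} {x : ι → K}
    (hx : x ∈ piPrimePowBall K ι k \ piPrimePowBall K ι (k + 1)) {b : K} (hb : b ∈ primePowBall K (n + k)) :
    sliceDensity μ x ((piPrimePowBall K ι n).indicator fun _ => (1 : ℂ)) b =
      ((μ.real (primePowBall K (n + k)))⁻¹ * (Measure.pi fun _ : ι => μ).real (piPrimePowBall K ι n) : ℝ) := by
  rw [sliceDensity_indicator_box μ hx b, ← Complex.ofReal_mul]
  congr 3
  -- the slab condition is automatic on the box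
  ext y
  simp only [mem_inter_iff, mem_setOf_eq, and_iff_right_iff_imp]
  intro hy
  rw [mem_vadd_primePowBall_iff]
  have hxy : x ⬝ᵥ y ∈ primePowBall K (n + k) := dotProduct_mem_primePowBall_of_mem hx.1 hy
  have : x ⬝ᵥ y - b = x ⬝ᵥ y + -b := sub_eq_add_neg _ _
  rw [this]
  exact add_mem_primePowBall hxy (neg_mem_primePowBall hb)

/-- **POSITIVITY OF THE FIBRE DENSITY OF A BOX AT EVERY DEEP ENOUGH `b`**: `Re F_{𝟙_{(𝔭^n)^ι × (𝔭^n)^ι}}(b) > 0` for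
`b ∈ 𝔭^{2n}` — the `x`-integrand `Re s(x, ·; b)` is `≥ 0` and equals the constant `μ(𝔭^{2n})⁻¹ μ^ι((𝔭^n)^ι) > 0` on the shell
of level `n`, which has positive measure. (For `n = 0`, `b = 0` this is `re_fibreDensity_indicator_zero_pos`.)
[cite: Weil1965, Chap. V n° 50 Thm 4, p. 72] -/
theorem re_fibreDensity_indicator_boxProd_pos [Nonempty ι] [DecidableEq ι] [MeasurableSingletonClass K]
    (hι : 2 ≤ Fintype.card ι) {n : ℤ} {b : K} (hb : b ∈ primePowBall K (n + n)) :
    0 < (fibreDensity μ ((piPrimePowBall K ι n ×ˢ piPrimePowBall K ι n).indicator (fun _ => (1 : ℂ))) b).re := by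
  haveI : SecondCountableTopology K := secondCountableS
  haveI := sigmaFiniteS μ
  set Φ : (ι → K) × (ι → K) → ℂ := (piPrimePowBall K ι n ×ˢ piPrimePowBall K ι n).indicator (fun _ => (1 : ℂ)) with hΦ
  obtain ⟨ℓ, n₀, A, hinv, hsupp, hA⟩ := exists_structure_of_mem_schwartzBruhat
    (indicator_box_prod_box_mem_schwartzBruhat (K := K) (ι := ι) n)
  have hΦm : Measurable Φ := measurable_of_mem_schwartzBruhat (indicator_box_prod_box_mem_schwartzBruhat n)
  have hint : Integrable (fun x => sliceDensity μ x (fun y => Φ (x, y)) b) (Measure.pi fun _ : ι => μ) :=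
    integrable_sliceDensity μ hι hinv hsupp hA hΦm b
  -- the slices of `Φ`
  have hslice_in : ∀ x ∈ piPrimePowBall K ι n, (fun y => Φ (x, y)) = (piPrimePowBall K ι n).indicator fun _ => (1 : ℂ) := by
    intro x hx
    funext y
    by_cases hy : y ∈ piPrimePowBall K ι n
    · rw [hΦ, Set.indicator_of_mem (Set.mk_mem_prod hx hy), Set.indicator_of_mem hy]
    · rw [hΦ, Set.indicator_of_notMem (fun h => hy h.2), Set.indicator_of_notMem hy]
  have hslice_out : ∀ x ∉ piPrimePowBall K ι n, (fun y => Φ (x, y)) = fun _ => 0 := by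
    intro x hx
    funext y
    rw [hΦ, Set.indicator_of_notMem (fun h => hx h.1)]
  -- the constant and the shell
  set c : ℝ := (μ.real (primePowBall K (n + n)))⁻¹ * (Measure.pi fun _ : ι => μ).real (piPrimePowBall K ι n) with hc
  have hcpos : 0 < c := mul_pos (inv_pos.2 (measureReal_primePowBall_pos μ _)) (measureReal_piPrimePowBall_pos _ n)
  set Sh : Set (ι → K) := piPrimePowBall K ι n \ piPrimePowBall K ι (n + 1) with hSh
  have hShm : MeasurableSet Sh := (measurableSet_piPrimePowBall' n).diff (measurableSet_piPrimePowBall' (n + 1))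
  have hae : ∀ᵐ x ∂(Measure.pi fun _ : ι => μ), x ≠ (0 : ι → K) := by
    have h := measure_eq_zero_iff_ae_notMem.1 (measure_pi_singleton_zero (ι := ι) μ)
    filter_upwards [h] with x hx using fun h0 => hx (h0 ▸ Set.mem_singleton _)
  have hlow : ∀ᵐ x ∂(Measure.pi fun _ : ι => μ),
      Sh.indicator (fun _ => c) x ≤ (sliceDensity μ x (fun y => Φ (x, y)) b).re := by
    filter_upwards [hae] with x hx0
    by_cases hxS : x ∈ Sh
    · rw [Set.indicator_of_mem hxS, hslice_in x hxS.1, sliceDensity_indicator_box_of_mem μ hxS hb,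
        Complex.ofReal_re]
    · rw [Set.indicator_of_notMem hxS]
      by_cases hx : x ∈ piPrimePowBall K ι n
      · rw [hslice_in x hx]
        exact re_sliceDensity_indicator_box_nonneg μ n hx0 b
      · rw [hslice_out x hx, sliceDensity_zero_fun, Complex.zero_re]
  have hre : (fibreDensity μ Φ b).re = ∫ x, (sliceDensity μ x (fun y => Φ (x, y)) b).re ∂(Measure.pi fun _ : ι => μ) := by
    have h := integral_re hint
    simp only [RCLike.re_to_complex] at h
    rw [fibreDensity, ← h]
  rw [hre]
  have hShfin : (Measure.pi fun _ : ι => μ) Sh < ⊤ :=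
    (measure_mono Set.sdiff_subset).trans_lt (measure_pi_piPrimePowBall_lt_top μ n)
  calc (0 : ℝ) < c * (Measure.pi fun _ : ι => μ).real Sh := mul_pos hcpos (measureReal_shell_pos μ n)
    _ = ∫ x, Sh.indicator (fun _ => c) x ∂(Measure.pi fun _ : ι => μ) := by
        rw [integral_indicator_const _ hShm, smul_eq_mul, mul_comm]
    _ ≤ ∫ x, (sliceDensity μ x (fun y => Φ (x, y)) b).re ∂(Measure.pi fun _ : ι => μ) :=
        integral_mono_ae ((integrable_indicator_iff hShm).2
          ((integrableOn_const_iff (C := c)).2 (Or.inr hShfin))) hint.re hlow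

/-- **`μ_{b,v} ≠ 0` FOR EVERY `b`** (the cone `b = 0` included): the box `(𝔭^n)^ι × (𝔭^n)^ι` with `b ∈ 𝔭^{2n}` has positive
mass `Re F_{𝟙}(b)` (★ `integral_fibreMeasure_eq_fibreDensity`). [cite: Weil1965, Chap. V n° 50 Thm 4, p. 72] -/
theorem fibreMeasure_ne_zero [Nonempty ι] [DecidableEq ι] [MeasurableSingletonClass K]
    (hι : 2 ≤ Fintype.card ι) (b : K) : fibreMeasure μ hι b ≠ 0 := by
  haveI : T2Space K := t2S
  -- a box deep enough for `b`
  obtain ⟨m, hm⟩ := exists_mem_primePowBall b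
  set n : ℤ := min m 0 with hn
  have hb : b ∈ primePowBall K (n + n) := primePowBall_antitone (by omega) hm
  set B : Set ((ι → K) × (ι → K)) := piPrimePowBall K ι n ×ˢ piPrimePowBall K ι n with hB
  have hBclopen : IsClopen B :=
    ⟨(isClosed_piPrimePowBall n).prod (isClosed_piPrimePowBall n), (isOpen_piPrimePowBall n).prod (isOpen_piPrimePowBall n)⟩
  set Φr : (ι → K) × (ι → K) → ℝ := B.indicator fun _ => (1 : ℝ) with hΦr
  have hlc : IsLocallyConstant Φr := isLocallyConstant_indicator_const hBclopen (1 : ℝ)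
  have hs : ∀ z, z ∉ piPrimePowBall K ι n ×ˢ piPrimePowBall K ι n → Φr z = 0 := fun z hz =>
    Set.indicator_of_notMem hz _
  have hid := integral_fibreMeasure_eq_fibreDensity μ hι b hlc hs
  have hcast : (fun z => (Φr z : ℂ)) = B.indicator fun _ => (1 : ℂ) := by
    funext z
    by_cases hz : z ∈ B
    · rw [hΦr, Set.indicator_of_mem hz, Set.indicator_of_mem hz, Complex.ofReal_one]
    · rw [hΦr, Set.indicator_of_notMem hz, Set.indicator_of_notMem hz, Complex.ofReal_zero]
  rw [hcast] at hid
  have hpos := re_fibreDensity_indicator_boxProd_pos μ hι (ι := ι) hb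
  rw [← hid, Complex.ofReal_re] at hpos
  intro h0
  rw [h0, integral_zero_measure] at hpos
  exact lt_irrefl 0 hpos

/-! ## §5 The cone `b = 0`: the degenerate orbits `{x = 0}`, `{y = 0}` are `μ_{0,v}`-null -/

omit [BorelSpace K] in
/-- the real fibre averages are symmetric under `(x, y) ↦ (y, x)` (`x ⬝ᵥ y = y ⬝ᵥ x`, and `μ^ι × μ^ι` is swap-invariant).
[cite: Weil1965, Chap. IV n° 44 Thm 2, p. 63] -/
theorem fibreAvgReal_comp_swap (f : (ι → K) × (ι → K) → ℝ) (b : K) (r : ℤ) :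
    fibreAvgReal μ (fun z => f z.swap) b r = fibreAvgReal μ f b r := by
  haveI := sigmaFiniteS μ
  unfold fibreAvgReal
  congr 1
  have h := integral_prod_swap (μ := Measure.pi fun _ : ι => μ) (ν := Measure.pi fun _ : ι => μ)
    (fun z : (ι → K) × (ι → K) => (b +ᵥ primePowBall K r).indicator (1 : K → ℝ) (z.1 ⬝ᵥ z.2) * f z)
  rw [← h]
  refine integral_congr_ae (Eventually.of_forall fun z => ?_)
  simp only [Prod.fst_swap, Prod.snd_swap, dotProduct_comm z.2 z.1]

/-- hence the fibre functional is swap-invariant. [cite: Weil1965, Chap. IV n° 44 Thm 2, p. 63] -/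
theorem fibreFunctional_comp_swap [Nonempty ι] [DecidableEq ι] [MeasurableSingletonClass K] (hι : 2 ≤ Fintype.card ι)
    (b : K) (f fS : C_c((ι → K) × (ι → K), ℝ)) (hfS : ∀ z, fS z = f z.swap) :
    fibreFunctional μ hι b fS = fibreFunctional μ hι b f := by
  have h1 := tendsto_fibreFunctional μ hι b fS
  have h2 := tendsto_fibreFunctional μ hι b f
  have h3 : Tendsto (fun r : ℤ => fibreAvgReal μ fS b r) atTop (𝓝 (fibreFunctional μ hι b f)) := by
    refine h2.congr fun r => ?_
    have : (⇑fS : (ι → K) × (ι → K) → ℝ) = fun z => f z.swap := funext hfS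
    rw [this, fibreAvgReal_comp_swap μ]
  exact tendsto_nhds_unique h1 h3

/-- **`μ_{b,v}` is symmetric**: `swap_* μ_{b,v} = μ_{b,v}`. [cite: Weil1965, Chap. IV n° 44 Thm 2, p. 63] -/
theorem map_fibreMeasure_swap [Nonempty ι] [DecidableEq ι] [MeasurableSingletonClass K] (hι : 2 ≤ Fintype.card ι)
    (b : K) : (fibreMeasure μ hι b).map Prod.swap = fibreMeasure μ hι b :=
  map_fibreMeasure_homeomorph μ hι b (Homeomorph.prodComm (ι → K) (ι → K))
    (fun f fS hfS => fibreFunctional_comp_swap μ hι b f fS (fun z => hfS z))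

/-- preimage form of the symmetry. [cite: Weil1965, Chap. IV n° 44 Thm 2, p. 63] -/
theorem fibreMeasure_preimage_swap [Nonempty ι] [DecidableEq ι] [MeasurableSingletonClass K] (hι : 2 ≤ Fintype.card ι)
    (b : K) {A : Set ((ι → K) × (ι → K))} (hA : MeasurableSet A) :
    fibreMeasure μ hι b (Prod.swap ⁻¹' A) = fibreMeasure μ hι b A := by
  rw [← Measure.map_apply measurable_swap hA, map_fibreMeasure_swap μ hι b]

/-- **THE CONE MEASURE OF A PRODUCT OF BOXES**: `μ_{0,v}((𝔭^n)^ι × (𝔭^M)^ι) = μ^ι((𝔭^M)^ι) · ∫_{(𝔭^n)^ι} μ(𝔭^{M + level x})⁻¹ dμ^ι(x)`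
for `M ≤ n` (each `x ≠ 0` of the box, of level `k`, contributes the slice density `μ(𝔭^{M+k})⁻¹ μ^ι((𝔭^M)^ι)` —
`sliceDensity_indicator_box_of_mem` with `b = 0 ∈ 𝔭^{M+k}`; the weight is FILE A's `levelWeight μ M`).
[cite: Weil1965, Chap. III n° 37 Prop. 6, p. 54] -/
theorem integral_indicator_boxProd_fibreMeasure_zero [Nonempty ι] [DecidableEq ι] [MeasurableSingletonClass K]
    (hι : 2 ≤ Fintype.card ι) {n M : ℤ} (hMn : M ≤ n) :
    ∫ z, (piPrimePowBall K ι n ×ˢ piPrimePowBall K ι M).indicator (fun _ => (1 : ℝ)) z ∂(fibreMeasure μ hι 0) =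
      (Measure.pi fun _ : ι => μ).real (piPrimePowBall K ι M) *
        ∫ x in piPrimePowBall K ι n, levelWeight μ M x ∂(Measure.pi fun _ : ι => μ) := by
  haveI : SecondCountableTopology K := secondCountableS
  haveI : T2Space K := t2S
  haveI := sigmaFiniteS μ
  set B : Set ((ι → K) × (ι → K)) := piPrimePowBall K ι n ×ˢ piPrimePowBall K ι M with hB
  have hBclopen : IsClopen B :=
    ⟨(isClosed_piPrimePowBall n).prod (isClosed_piPrimePowBall M), (isOpen_piPrimePowBall n).prod (isOpen_piPrimePowBall M)⟩
  set Φr : (ι → K) × (ι → K) → ℝ := B.indicator fun _ => (1 : ℝ) with hΦr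
  have hlc : IsLocallyConstant Φr := isLocallyConstant_indicator_const hBclopen (1 : ℝ)
  have hs : ∀ z, z ∉ piPrimePowBall K ι M ×ˢ piPrimePowBall K ι M → Φr z = 0 := by
    intro z hz
    refine Set.indicator_of_notMem (fun hzB => hz ?_) _
    exact ⟨piPrimePowBall_antitone hMn hzB.1, hzB.2⟩
  have hid := integral_fibreMeasure_eq_fibreDensity μ hι 0 hlc hs
  -- the complexified `Φr` and its slices
  set Φ : (ι → K) × (ι → K) → ℂ := B.indicator fun _ => (1 : ℂ) with hΦ
  have hcast : (fun z => (Φr z : ℂ)) = Φ := by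
    funext z
    by_cases hz : z ∈ B
    · rw [hΦr, hΦ, Set.indicator_of_mem hz, Set.indicator_of_mem hz, Complex.ofReal_one]
    · rw [hΦr, hΦ, Set.indicator_of_notMem hz, Set.indicator_of_notMem hz, Complex.ofReal_zero]
  rw [hcast] at hid
  have hslice_in : ∀ x ∈ piPrimePowBall K ι n, (fun y => Φ (x, y)) = (piPrimePowBall K ι M).indicator fun _ => (1 : ℂ) := by
    intro x hx
    funext y
    by_cases hy : y ∈ piPrimePowBall K ι M
    · rw [hΦ, Set.indicator_of_mem (Set.mk_mem_prod hx hy), Set.indicator_of_mem hy]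
    · rw [hΦ, Set.indicator_of_notMem (fun h => hy h.2), Set.indicator_of_notMem hy]
  have hslice_out : ∀ x ∉ piPrimePowBall K ι n, (fun y => Φ (x, y)) = fun _ => 0 := by
    intro x hx
    funext y
    rw [hΦ, Set.indicator_of_notMem (fun h => hx h.1)]
  -- the `x`-integrand, a.e.: `𝟙_{(𝔭^n)^ι}(x) · levelWeight μ M x · μ^ι((𝔭^M)^ι)`
  set c : ℝ := (Measure.pi fun _ : ι => μ).real (piPrimePowBall K ι M) with hc
  have hae : ∀ᵐ x ∂(Measure.pi fun _ : ι => μ), x ≠ (0 : ι → K) := by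
    have h := measure_eq_zero_iff_ae_notMem.1 (measure_pi_singleton_zero (ι := ι) μ)
    filter_upwards [h] with x hx using fun h0 => hx (h0 ▸ Set.mem_singleton _)
  have hptw : ∀ᵐ x ∂(Measure.pi fun _ : ι => μ), sliceDensity μ x (fun y => Φ (x, y)) 0 =
      (((piPrimePowBall K ι n).indicator (fun x => levelWeight μ M x * c) x : ℝ) : ℂ) := by
    filter_upwards [hae] with x hx0
    by_cases hx : x ∈ piPrimePowBall K ι n
    · rw [hslice_in x hx, Set.indicator_of_mem hx,
        sliceDensity_indicator_box_of_mem μ (mem_shell_level hx0) (zero_mem_primePowBall _), levelWeight, hc]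
    · rw [hslice_out x hx, sliceDensity_zero_fun, Set.indicator_of_notMem hx, Complex.ofReal_zero]
  have hF : fibreDensity μ Φ 0 = ((c * ∫ x in piPrimePowBall K ι n, levelWeight μ M x ∂(Measure.pi fun _ : ι => μ) : ℝ) : ℂ) := by
    rw [fibreDensity, integral_congr_ae hptw, integral_complex_ofReal, integral_indicator (measurableSet_piPrimePowBall' n),
      integral_mul_const, mul_comm]
  rw [hF] at hid
  exact_mod_cast hid

omit [MeasurableSpace K] [BorelSpace K] in
/-- the boxes `(𝔭^n)^ι`, `n → ∞`, shrink to the origin. [cite: WeilBNT1967, Ch. II §2, Def. 2] -/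
theorem iInter_piPrimePowBall_nat [Nonempty ι] : (⋂ n : ℕ, piPrimePowBall K ι (n : ℤ)) = {0} := by
  ext x
  simp only [mem_iInter, mem_singleton_iff]
  constructor
  · intro h
    by_contra hx0
    have hsh := mem_shell_level hx0
    have hle : level x + 1 ≤ ((level x + 1).toNat : ℤ) := Int.self_le_toNat _
    exact hsh.2 (piPrimePowBall_antitone hle (h _))
  · rintro rfl n
    exact zero_mem_piPrimePowBall _

/-- **the level weight has vanishing mass on shrinking boxes**: `∫_{(𝔭^n)^ι} μ(𝔭^{M+level x})⁻¹ dμ^ι(x) → 0` (`n → ∞`) — the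
weight is integrable near `0` for `|ι| ≥ 2` (★ `integrableOn_levelWeight`) and the boxes shrink to the null point `0`.
[cite: Weil1965, Chap. III n° 37 Prop. 6, p. 54] -/
theorem tendsto_setIntegral_levelWeight_box [Nonempty ι] [MeasurableSingletonClass K] (hι : 2 ≤ Fintype.card ι) (M : ℤ) :
    Tendsto (fun n : ℕ => ∫ x in piPrimePowBall K ι (n : ℤ), levelWeight μ M x ∂(Measure.pi fun _ : ι => μ)) atTop (𝓝 0) := by
  have h := tendsto_setIntegral_of_antitone (μ := Measure.pi fun _ : ι => μ) (f := levelWeight μ M)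
    (s := fun n : ℕ => piPrimePowBall K ι (n : ℤ)) (fun n => measurableSet_piPrimePowBall' (n : ℤ))
    (fun n m hnm => piPrimePowBall_antitone (by exact_mod_cast hnm)) ⟨0, by exact_mod_cast integrableOn_levelWeight μ hι M 0⟩
  rw [iInter_piPrimePowBall_nat, setIntegral_measure_zero _ (measure_pi_singleton_zero μ)] at h
  exact h

/-- `μ_{0,v}({0} × (𝔭^M)^ι) = 0`: squeezed by `μ_{0,v}((𝔭^n)^ι × (𝔭^M)^ι) → 0`. [cite: Weil1965, Chap. III n° 37 Prop. 6, p. 54] -/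
theorem fibreMeasure_zero_singleton_prod_box [Nonempty ι] [DecidableEq ι] [MeasurableSingletonClass K]
    (hι : 2 ≤ Fintype.card ι) (M : ℤ) :
    fibreMeasure μ hι 0 (({0} : Set (ι → K)) ×ˢ piPrimePowBall K ι M) = 0 := by
  haveI : SecondCountableTopology K := secondCountableS
  haveI : T2Space K := t2S
  haveI := isFiniteMeasureOnCompacts_fibreMeasure μ hι (0 : K)
  -- `μ_{0,v}(box n × box M)` as a real integral, for `n ≥ M`
  have hbox : ∀ n : ℕ, M ≤ (n : ℤ) → fibreMeasure μ hι 0 (({0} : Set (ι → K)) ×ˢ piPrimePowBall K ι M) ≤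
      ENNReal.ofReal ((Measure.pi fun _ : ι => μ).real (piPrimePowBall K ι M) *
        ∫ x in piPrimePowBall K ι (n : ℤ), levelWeight μ M x ∂(Measure.pi fun _ : ι => μ)) := by
    intro n hn
    have hsub : (({0} : Set (ι → K)) ×ˢ piPrimePowBall K ι M) ⊆ piPrimePowBall K ι (n : ℤ) ×ˢ piPrimePowBall K ι M :=
      Set.prod_mono (by rintro x rfl; exact zero_mem_piPrimePowBall _) le_rfl
    have hfin : fibreMeasure μ hι 0 (piPrimePowBall K ι (n : ℤ) ×ˢ piPrimePowBall K ι M) ≠ ⊤ :=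
      (((isCompact_piPrimePowBall (n : ℤ)).prod (isCompact_piPrimePowBall M)).measure_lt_top).ne
    rw [← integral_indicator_boxProd_fibreMeasure_zero μ hι hn, integral_indicator_const _
      ((measurableSet_piPrimePowBall' (n : ℤ)).prod (measurableSet_piPrimePowBall' M)), smul_eq_mul, mul_one,
      ofReal_measureReal hfin]
    exact measure_mono hsub
  have hlim : Tendsto (fun n : ℕ => ENNReal.ofReal ((Measure.pi fun _ : ι => μ).real (piPrimePowBall K ι M) *
      ∫ x in piPrimePowBall K ι (n : ℤ), levelWeight μ M x ∂(Measure.pi fun _ : ι => μ))) atTop (𝓝 0) := by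
    have h := (tendsto_setIntegral_levelWeight_box μ hι M).const_mul ((Measure.pi fun _ : ι => μ).real (piPrimePowBall K ι M))
    rw [mul_zero] at h
    simpa only [ENNReal.ofReal_zero] using ENNReal.tendsto_ofReal h
  refine le_antisymm ?_ bot_le
  refine ge_of_tendsto hlim ?_
  refine eventually_atTop.2 ⟨M.toNat, fun n hn => hbox n ?_⟩
  exact (Int.self_le_toNat M).trans (by exact_mod_cast hn)

/-- **THE DEGENERATE ORBIT `{x = 0}` OF THE CONE IS `μ_{0,v}`-NULL** (`|ι| ≥ 2`). [cite: Weil1965, Chap. V n° 49 Lemma 22, p. 70] -/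
theorem fibreMeasure_zero_fst_eq_zero [Nonempty ι] [DecidableEq ι] [MeasurableSingletonClass K]
    (hι : 2 ≤ Fintype.card ι) : fibreMeasure μ hι 0 {z : (ι → K) × (ι → K) | z.1 = 0} = 0 := by
  have hcover : {z : (ι → K) × (ι → K) | z.1 = 0} ⊆ ⋃ N : ℕ, (({0} : Set (ι → K)) ×ˢ piPrimePowBall K ι (-(N : ℤ))) := by
    intro z hz
    obtain ⟨N, hN⟩ := exists_mem_piPrimePowBall z.2
    exact Set.mem_iUnion.2 ⟨N, Set.mk_mem_prod hz hN⟩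
  refine measure_mono_null hcover ?_
  exact measure_iUnion_null fun N => fibreMeasure_zero_singleton_prod_box μ hι (-(N : ℤ))

/-- **THE DEGENERATE ORBIT `{y = 0}` OF THE CONE IS `μ_{0,v}`-NULL** (by the symmetry `swap_* μ_{0,v} = μ_{0,v}`).
[cite: Weil1965, Chap. V n° 49 Lemma 22, p. 70] -/
theorem fibreMeasure_zero_snd_eq_zero [Nonempty ι] [DecidableEq ι] [MeasurableSingletonClass K]
    (hι : 2 ≤ Fintype.card ι) : fibreMeasure μ hι 0 {z : (ι → K) × (ι → K) | z.2 = 0} = 0 := by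
  haveI : SecondCountableTopology K := secondCountableS
  have hset : {z : (ι → K) × (ι → K) | z.2 = 0} = Prod.swap ⁻¹' {z : (ι → K) × (ι → K) | z.1 = 0} := by
    ext z
    simp
  have hm : MeasurableSet {z : (ι → K) × (ι → K) | z.1 = 0} :=
    (measurableSet_singleton (0 : ι → K)).preimage measurable_fst
  rw [hset, fibreMeasure_preimage_swap μ hι 0 hm]
  exact fibreMeasure_zero_fst_eq_zero μ hι

/-- **`μ_{b,v}` IS CARRIED BY THE `GL`-ORBIT `S_b = {x ⬝ᵥ y = b, x ≠ 0, y ≠ 0}` FOR EVERY `b`** — for `b ≠ 0` because the fibre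
is `S_b`; for the cone `b = 0` because the two degenerate orbits `{x = 0}`, `{y = 0}` (the isotropic vectors NOT of maximal
rank, Weil's `F = X − U`) are null. This is the carrier hypothesis of `exists_eq_smul_of_dotProduct_invariant`.
[cite: Weil1965, Chap. V n° 49 Lemma 22, p. 70] -/
theorem fibreMeasure_compl_splitLocus [Nonempty ι] [DecidableEq ι] [MeasurableSingletonClass K]
    (hι : 2 ≤ Fintype.card ι) (b : K) :
    fibreMeasure μ hι b {z : (ι → K) × (ι → K) | z.1 ⬝ᵥ z.2 = b ∧ z.1 ≠ 0 ∧ z.2 ≠ 0}ᶜ = 0 := by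
  by_cases hb : b ≠ 0
  · exact fibreMeasure_compl_splitLocus_of_ne_zero μ hι hb
  · push Not at hb
    subst hb
    have hsub : {z : (ι → K) × (ι → K) | z.1 ⬝ᵥ z.2 = 0 ∧ z.1 ≠ 0 ∧ z.2 ≠ 0}ᶜ ⊆
        ({z : (ι → K) × (ι → K) | z.1 ⬝ᵥ z.2 = 0}ᶜ ∪ {z | z.1 = 0}) ∪ {z | z.2 = 0} := by
      intro z hz
      simp only [mem_compl_iff, mem_setOf_eq, not_and, not_not, mem_union] at hz ⊢
      by_cases h0 : z.1 ⬝ᵥ z.2 = 0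
      · by_cases h1 : z.1 = 0
        · exact Or.inl (Or.inr h1)
        · exact Or.inr (hz h0 h1)
      · exact Or.inl (Or.inl h0)
    refine measure_mono_null hsub (measure_union_null (measure_union_null ?_ ?_) ?_)
    · exact fibreMeasure_compl_fibre μ hι 0
    · exact fibreMeasure_zero_fst_eq_zero μ hι
    · exact fibreMeasure_zero_snd_eq_zero μ hι

/-! ## §6 The uniqueness junction (with `SplitPlaceInvariantMeasureUniqueness`) -/

/-- **THE FIBRE MEASURE IS THE UNIQUE `GL_N(K)`-INVARIANT MEASURE ON `U(b)_v` UP TO A SCALAR — EVERY `b`, THE CONE INCLUDED**: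
every Borel measure `ν` on `K^ι × K^ι` that is finite on compact sets, invariant under `(x, y) ↦ (g x, (g⁻¹)ᵀ y)`
(`g ∈ GL_ι(K)`) and carried by `S_b = {x ⬝ᵥ y = b, x ≠ 0, y ≠ 0}` is `c • μ_{b,v}` for some `c ≥ 0` — B-p21's uniqueness
`exists_eq_smul_of_dotProduct_invariant` with `μ′ := μ_{b,v}` (invariant by `fibreMeasure_preimage_gl`, carried by `S_b` by
`fibreMeasure_compl_splitLocus`, non-zero by `fibreMeasure_ne_zero`). At a split place this identifies the theta-side orbital
measure on Weil's `U(b)_v` (isotropic vectors OF MAXIMAL RANK when `b = 0`) with a multiple of Weil's `|θ_b|_v`.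
[cite: Weil1965, Chap. V n° 49 Lemma 22, p. 70] -/
theorem exists_eq_smul_fibreMeasure [Nonempty ι] [DecidableEq ι] [MeasurableSingletonClass K]
    (hι : 2 ≤ Fintype.card ι) (b : K) (ν : Measure ((ι → K) × (ι → K))) [IsFiniteMeasureOnCompacts ν]
    (hν : ∀ (g : GL ι K) (A : Set ((ι → K) × (ι → K))), MeasurableSet A →
      ν ((fun z => (((g : Matrix ι ι K) *ᵥ z.1, ((g⁻¹ : GL ι K) : Matrix ι ι K)ᵀ *ᵥ z.2) :
        (ι → K) × (ι → K))) ⁻¹' A) = ν A)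
    (hcar : ν {z : (ι → K) × (ι → K) | z.1 ⬝ᵥ z.2 = b ∧ z.1 ≠ 0 ∧ z.2 ≠ 0}ᶜ = 0) :
    ∃ c : ℝ≥0, ν = c • fibreMeasure μ hι b := by
  haveI := isFiniteMeasureOnCompacts_fibreMeasure μ hι b
  exact exists_eq_smul_of_dotProduct_invariant b ν (fibreMeasure μ hι b) hν
    (fun g A hA => fibreMeasure_preimage_gl μ hι b g hA) hcar (fibreMeasure_compl_splitLocus μ hι b)
    (fibreMeasure_ne_zero μ hι b) hι

/-- **WEIL'S LEMME 22 AT THE SPLIT PLACE, RELATIVE FORM, WITH THE FIBRE MEASURE AS REFERENCE**: for a measure `μ` on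
`(K^ι × K^ι) × Y` (`Y` any measurable space — the prime-to-`v` factor) and `B ⊆ Y` with finite, `GL_ι(K)`-invariant rectangle
masses `μ(A × B)` carried by `S_b × B`, there is `c_B ≥ 0` with `μ(A × B) = c_B · μ_{b,v}(A)` for every Borel `A` — every
`b`, the cone included. [cite: Weil1965, Chap. V n° 49 Lemma 22, p. 70] -/
theorem exists_measure_prod_splitLocus_eq_mul_fibreMeasure [Nonempty ι] [DecidableEq ι] [MeasurableSingletonClass K]
    (hι : 2 ≤ Fintype.card ι) (b : K) {Y : Type*} [MeasurableSpace Y]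
    (ν : Measure (((ι → K) × (ι → K)) × Y)) {B : Set Y}
    (hfin : ∀ C : Set ((ι → K) × (ι → K)), IsCompact C → ν (C ×ˢ B) < ⊤)
    (hinv : ∀ (g : GL ι K) (A : Set ((ι → K) × (ι → K))), MeasurableSet A →
      ν (((fun z => (((g : Matrix ι ι K) *ᵥ z.1, ((g⁻¹ : GL ι K) : Matrix ι ι K)ᵀ *ᵥ z.2) :
        (ι → K) × (ι → K))) ⁻¹' A) ×ˢ B) = ν (A ×ˢ B))
    (hcar : ν ({z : (ι → K) × (ι → K) | z.1 ⬝ᵥ z.2 = b ∧ z.1 ≠ 0 ∧ z.2 ≠ 0}ᶜ ×ˢ B) = 0) :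
    ∃ c : ℝ≥0, ∀ A : Set ((ι → K) × (ι → K)), MeasurableSet A → ν (A ×ˢ B) = c * fibreMeasure μ hι b A := by
  haveI := isFiniteMeasureOnCompacts_fibreMeasure μ hι b
  exact exists_measure_prod_splitLocus_eq_mul b (fibreMeasure μ hι b) (fun g A hA => fibreMeasure_preimage_gl μ hι b g hA)
    (fibreMeasure_compl_splitLocus μ hι b) (fibreMeasure_ne_zero μ hι b) ν hfin hinv hcar hι

/-- the `∫⁻` form: `∫⁻ (z, y), f z · 𝟙_B y dμ = c_B · ∫⁻ f dμ_{b,v}` for Borel `f ≥ 0` — Weil's `μ(Φ_v ⊗ Φ′) = c(Φ′) |θ_b|_v(Φ_v)`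
on product test functions, with the reference measure `|θ_b|_v = μ_{b,v}` EXPLICIT (so that the scaling law and the continuity
`b ↦ F_Φ(b)` of FILE A apply to the right-hand side). [cite: Weil1965, Chap. V n° 49 Lemma 22, p. 70] -/
theorem exists_lintegral_fst_mul_indicator_snd_eq_mul_fibreMeasure [Nonempty ι] [DecidableEq ι] [MeasurableSingletonClass K]
    (hι : 2 ≤ Fintype.card ι) (b : K) {Y : Type*} [MeasurableSpace Y]
    (ν : Measure (((ι → K) × (ι → K)) × Y)) {B : Set Y} (hB : MeasurableSet B)
    (hfin : ∀ C : Set ((ι → K) × (ι → K)), IsCompact C → ν (C ×ˢ B) < ⊤)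
    (hinv : ∀ (g : GL ι K) (A : Set ((ι → K) × (ι → K))), MeasurableSet A →
      ν (((fun z => (((g : Matrix ι ι K) *ᵥ z.1, ((g⁻¹ : GL ι K) : Matrix ι ι K)ᵀ *ᵥ z.2) :
        (ι → K) × (ι → K))) ⁻¹' A) ×ˢ B) = ν (A ×ˢ B))
    (hcar : ν ({z : (ι → K) × (ι → K) | z.1 ⬝ᵥ z.2 = b ∧ z.1 ≠ 0 ∧ z.2 ≠ 0}ᶜ ×ˢ B) = 0) :
    ∃ c : ℝ≥0, ∀ f : (ι → K) × (ι → K) → ℝ≥0∞, Measurable f →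
      ∫⁻ p, f p.1 * B.indicator 1 p.2 ∂ν = c * ∫⁻ z, f z ∂(fibreMeasure μ hι b) := by
  haveI := isFiniteMeasureOnCompacts_fibreMeasure μ hι b
  exact exists_lintegral_fst_mul_indicator_snd_splitLocus_eq_mul b (fibreMeasure μ hι b)
    (fun g A hA => fibreMeasure_preimage_gl μ hι b g hA) (fibreMeasure_compl_splitLocus μ hι b) (fibreMeasure_ne_zero μ hι b)
    ν hB hfin hinv hcar hι

end Literature.NumberTheory.Weil1965.SplitPlace
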